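import Summits.HodgeConjecture.HodgeConjecture.Theorems.F0P3FinPartConstituentTransfer   -- ★ T♭-core (p03 g5): `smoothConstituents_iff_of_hasFinComponent`; cone: ★ I♭, ★ `isUnitary_toContRep`
import Summits.HodgeConjecture.HodgeConjecture.Theorems.F0P2cStubCLLocalTypeExists        -- ★ P2-CL (F0P2-p03 g2): `stubCL_holds` — an irreducible LOCAL TYPE at every finite place
import Mathlib.Analysis.InnerProductSpace.Adjoint
import HarnessLib

/-!
# Crux `H413` — rung 4 (T5 pin «UNITARY»): the LOCAL CONSTITUENTS of a discrete automorphic representation of `U(J)` at a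
# finite place are UNITARIZABLE (every constituent class has a representative carrying an invariant positive-definite Hermitian form)

Floor-0 programme P3 «U3-mult», seat F0P3-p02 (g6); crux item stmt-HodgeConjecture-24833 (`HCCMUnconditional.H413`); `PLAN.F0P3g4.md`
§24 Z6 ∕ Z3 and REF1 (g4) R-6 ∕ R-7: the letters (L2) «linear independence of characters» [Rogawski1990 Prop. 13.8.1] and (L1)
«separation by Hecke eigenvalues» [§13.7 p. 206] are TRUE ONLY FOR UNITARY representations (the non-unitary theta counterexample,
`F0/P3/F0P3-p02/MEMO-B3-L2-shape.F0P3p02g6.md`), so the T5 kit must RECORD that what it feeds them — the local constituents of a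
discrete `P` — is unitarizable.  This file proves that pin IN-HOUSE.  PROOF lane: no `def`, no `sorry`, no named fact;
`--supports stmt-HodgeConjecture-24833`.  HONEST LABEL: HC_CM is proved only modulo the printed citations until rung 0 closes; this
file discharges none of them.

THE ARGUMENT (all inputs ★).  §1 (generic): the restriction of a UNITARY Hilbert representation `π` along any homomorphism
`β : B →* Γ` is unitarizable on the nose (the inner product; Mathlib `inner_map_map_of_mem_unitary`), unitarizability pulls back
along an INJECTIVE intertwining linear map (restrict the form), and passes along `Representation.comp`.  §2: for `σ` irreducible
occurring in `P` (★ `HasFinComponent`), the injective intertwiner `σ ↪ P.finRep = P.space.toContRep ∘ finAdelicToAdelic` of ★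
`exists_equivariant_ne_zero_of_hasFinComponent` makes `σ` unitarizable (★ `isUnitary_toContRep`).  §3: a constituent class `c₀` of
`P.finRep^∞ ∘ inclPlace v` is a constituent of `σ ∘ inclPlace v` (★ T♭-core `smoothConstituents_iff_of_hasFinComponent`, `σ` admissible);
★ P2-CL `stubCL_holds` gives an irreducible local type `τ_v` with `isotypicComponent ℂ[U(J)(F_v)] (σ ∘ ι_v) τ_v = ⊤`, so (★ Σ♭
`IsConstituentOf.of_isotypicComponent_eq_top_comp` at `e = id` + ★ `IsConstituentOf.nonempty_equiv_of_isIrreducible`) a representative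
`r` of `c₀` is `≅ τ_v`; and `τ_v` is realised on a `ℂ[U(J)(F_v)]`-submodule of `σ` (a non-empty isotypic component), hence is
unitarizable by §1 (Mathlib `Representation.IntertwiningMap.equivLinearMapAsModule`), hence so is `r.ρ`.

* §1 `isUnitarizable_comp_of_isUnitary`, `isUnitarizable_of_injective`, `isUnitarizable_comp`, `isUnitarizable_of_isotypicComponent_eq_top`.
* §2 `isUnitarizable_of_hasFinComponent` — an irreducible finite component of a discrete `P` is unitarizable.
* §3 `exists_unitarizable_rep_of_isConstituentOf_comp_inclPlace`, **`exists_unitarizable_rep_of_isConstituentOf_finRepSmooth_comp`**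
  (generic frame `F E c N J`); §4 **`exists_unitarizable_rep_of_comap_isConstituentOf_cm`** (CM frame, D6 (b2′) binder types).

NOT HERE: admissibility of the constituent class (irreducible ⇒ admissible is Bernstein–Jacquet, a letter; the local type of ★ P2-CL
is admissible by construction but its exported statement does not say so — an ED. 2 if the pin needs it).
References: J. Rogawski, Ann. of Math. Stud. 123 (1990), Prop. 13.8.1 p. 206 (UNITARY hypothesis), §14.6 [Rogawski1990];
A. Borel, H. Jacquet, PSPM 33.1 (1979) §4.6 (`L²_d` is unitary; `π ≅ ⊗ π_v`) [BorelJacquet1979]; D. Flath, PSPM 33.1 (1979) Thm. 3 [FlathCorvallis1979];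
C. Bushnell, G. Henniart, *The local Langlands conjecture for GL(2)* (2006) §1.1, §2.6 [BushnellHenniart2006].
-/

set_option autoImplicit false
-- the mandated namespace repeats `HodgeConjecture.HodgeConjecture`, as in every `Theorems/*.lean` of this sub-problem
set_option linter.dupNamespace false

noncomputable section

open scoped MonoidAlgebra InnerProductSpace
open MeasureTheory NumberField IsDedekindDomain

namespace Summit.HodgeConjecture.HodgeConjecture.Cruxes.H413.F0P3LocalConstituentsUnitary

open Literature.NumberTheory.Automorphic Literature.NumberTheory.Automorphic.UnitaryGroup
open Summit.HodgeConjecture.HodgeConjecture.Cruxes.H413.F0P3FinPartIsotypic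
open Summit.HodgeConjecture.HodgeConjecture.Cruxes.H413.F0P3FinPartConstituentTransfer
open Summit.HodgeConjecture.HodgeConjecture.Cruxes.H413.F0P3TranslateDetection (isUnitary_toContRep)

/-! ## §1 Generic: unitary Hilbert representations restrict to unitarizable ones; pull-back along injective intertwiners -/

section Generic

/-- **The restriction of a UNITARY Hilbert representation along a homomorphism `β : B →* Γ` is unitarizable**, with the inner
product itself as the invariant positive-definite Hermitian form (Mathlib `inner_map_map_of_mem_unitary`, `inner_self_eq_norm_sq`).
[cite: BorelJacquet1979, §4.6] -/
theorem isUnitarizable_comp_of_isUnitary {Γ B H : Type*} [Group Γ] [Group B] [NormedAddCommGroup H] [InnerProductSpace ℂ H]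
    [CompleteSpace H] (π : ContRepresentation ℂ Γ H) (hπ : π.IsUnitary) (β : B →* Γ) :
    Representation.IsUnitarizable (π.toRepresentation.comp β) := by
  refine ⟨LinearMap.mk₂'ₛₗ (starRingEnd ℂ) (RingHom.id ℂ) (fun x y : H => ⟪x, y⟫_ℂ)
      (fun x x' y => inner_add_left x x' y) (fun a x y => inner_smul_left x y a)
      (fun x y y' => inner_add_right x y y') (fun a x y => inner_smul_right x y a), ?_, ?_, ?_⟩
  · exact ⟨fun x y => inner_conj_symm y x⟩
  · intro v hv
    change 0 < RCLike.re ⟪v, v⟫_ℂ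
    rw [inner_self_eq_norm_sq]
    exact pow_pos (norm_pos_iff.2 hv) 2
  · intro g v w
    change ⟪π (β g) v, π (β g) w⟫_ℂ = ⟪v, w⟫_ℂ
    exact ContinuousLinearMap.inner_map_map_of_mem_unitary (hπ (β g)) v w

/-- **Unitarizability pulls back along an injective intertwining linear map** (restrict the invariant form of `σ` along `f`;
definiteness by injectivity). [cite: BushnellHenniart2006, §2.6] -/
theorem isUnitarizable_of_injective {G V W : Type*} [Group G] [AddCommGroup V] [Module ℂ V] [AddCommGroup W] [Module ℂ W]
    {ρ : Representation ℂ G V} {σ : Representation ℂ G W} (f : V →ₗ[ℂ] W) (hf : ∀ (g : G) (v : V), f (ρ g v) = σ g (f v))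
    (hinj : Function.Injective f) (hσ : σ.IsUnitarizable) : ρ.IsUnitarizable := by
  obtain ⟨B, hBsymm, hBpos, hBinv⟩ := hσ
  refine ⟨LinearMap.mk₂'ₛₗ (starRingEnd ℂ) (RingHom.id ℂ) (fun x y : V => B (f x) (f y))
      (fun x x' y => by simp only [map_add, LinearMap.add_apply])
      (fun a x y => by simp only [map_smulₛₗ, LinearMap.smul_apply, smul_eq_mul, RingHom.id_apply])
      (fun x y y' => by simp only [map_add]) (fun a x y => by simp only [map_smul, RingHom.id_apply, smul_eq_mul]), ?_, ?_, ?_⟩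
  · exact ⟨fun x y => hBsymm.eq (f x) (f y)⟩
  · intro v hv
    exact hBpos (f v) fun h0 => hv (hinj (by rw [h0, map_zero]))
  · intro g v w
    change B (f (ρ g v)) (f (ρ g w)) = B (f v) (f w)
    rw [hf, hf, hBinv]

/-- Unitarizability passes to the restriction along a group homomorphism. [cite: BushnellHenniart2006, §2.6] -/
theorem isUnitarizable_comp {G B V : Type*} [Group G] [Group B] [AddCommGroup V] [Module ℂ V] {ρ : Representation ℂ G V}
    (hρ : ρ.IsUnitarizable) (β : B →* G) : Representation.IsUnitarizable (ρ.comp β) := by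
  obtain ⟨Bf, hBsymm, hBpos, hBinv⟩ := hρ
  exact ⟨Bf, hBsymm, hBpos, fun b v w => hBinv (β b) v w⟩

/-- **A representation realised on the isotypic component of a NON-TRIVIAL representation is unitarizable when the ambient one is**:
if `V` is non-trivial and `isotypicComponent ℂ[G] ρ.asModule τ.asModule = ⊤`, then some `ℂ[G]`-submodule of `ρ` is `ℂ[G]`-isomorphic to
`τ.asModule` (the supremum defining the isotypic component is over a non-empty family), i.e. `τ` embeds into `ρ` by an INTERTWINER
(Mathlib `Representation.IntertwiningMap.equivLinearMapAsModule`); so `τ` is unitarizable if `ρ` is.  (Without `Nontrivial V` the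
hypothesis `⊤ = ⊥`-trivially holds for every `τ` and the conclusion fails.) [cite: BushnellHenniart2006, §1.1 and §2.6] -/
theorem isUnitarizable_of_isotypicComponent_eq_top {G V T : Type*} [Group G] [AddCommGroup V] [Module ℂ V] [Nontrivial V]
    [AddCommGroup T] [Module ℂ T] {ρ : Representation ℂ G V} {τ : Representation ℂ G T}
    (htop : isotypicComponent ℂ[G] ρ.asModule τ.asModule = ⊤) (hρ : ρ.IsUnitarizable) : τ.IsUnitarizable := by
  -- the family of submodules `≅ τ` is non-empty
  have hne : {m : Submodule ℂ[G] ρ.asModule | Nonempty (m ≃ₗ[ℂ[G]] τ.asModule)}.Nonempty := by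
    by_contra hempty
    rw [Set.not_nonempty_iff_eq_empty] at hempty
    haveI : Nontrivial ρ.asModule := inferInstanceAs (Nontrivial V)
    have hbot : isotypicComponent ℂ[G] ρ.asModule τ.asModule = ⊥ := by
      rw [isotypicComponent, hempty, sSup_empty]
    exact top_ne_bot (htop.symm.trans hbot)
  obtain ⟨m, ⟨em⟩⟩ := hne
  -- the injective intertwiner `τ ↪ ρ`
  let F : τ.asModule →ₗ[ℂ[G]] ρ.asModule := m.subtype ∘ₗ em.symm.toLinearMap
  have hFinj : Function.Injective F := Subtype.val_injective.comp em.symm.injective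
  let φ : τ.IntertwiningMap ρ := (Representation.IntertwiningMap.equivLinearMapAsModule τ ρ).symm F
  have hφinj : Function.Injective φ.toLinearMap := fun a b h => hFinj h
  exact isUnitarizable_of_injective φ.toLinearMap (fun g t => Representation.IntertwiningMap.isIntertwining τ ρ φ g t) hφinj hρ

end Generic

/-! ## §2 An irreducible finite component of a discrete `P` is unitarizable -/

section FinComponent

variable {F E : Type} [Field F] [NumberField F] [Field E] [NumberField E] [Algebra F E] {c : E ≃ₐ[F] E} {N : ℕ}
  {J : Matrix (Fin N) (Fin N) E}
  {μ : Measure (adelicGroupData F E c N J).automorphicQuotient}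
  [SMulInvariantMeasure (adelicGroupData F E c N J).Adelic (adelicGroupData F E c N J).automorphicQuotient μ]

/-- **The finite part `P.finRep` of a discrete automorphic `P` is unitarizable** (it is the restriction of the unitary `P.space.toContRep`
along `finAdelicToAdelic`, ★ `isUnitary_toContRep`). [cite: BorelJacquet1979, §4.6] -/
theorem isUnitarizable_finRep (P : DiscreteAutomorphicRep (adelicGroupData F E c N J) μ) :
    Representation.IsUnitarizable P.finRep :=
  isUnitarizable_comp_of_isUnitary P.space.toContRep (isUnitary_toContRep P) (finAdelicToAdelic F E c N J)

/-- **An irreducible finite component `σ` of a discrete automorphic `P` is unitarizable**: pull the `L²` inner product back along the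
injective intertwiner `σ ↪ P.finRep` (★ `exists_equivariant_ne_zero_of_hasFinComponent`). [cite: BorelJacquet1979, §4.6] -/
theorem isUnitarizable_of_hasFinComponent (P : DiscreteAutomorphicRep (adelicGroupData F E c N J) μ)
    {W : Type} [AddCommGroup W] [Module ℂ W] (σ : Representation ℂ (finAdelic F E c N J) W)
    (hirr : σ.IsIrreducible) (hP : P.HasFinComponent σ) : σ.IsUnitarizable := by
  obtain ⟨f, hf, hfinj, -⟩ := exists_equivariant_ne_zero_of_hasFinComponent P σ hirr hP
  exact isUnitarizable_of_injective f hf hfinj (isUnitarizable_finRep P)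

end FinComponent

/-! ## §3 The local constituents at a finite place are unitarizable -/

section Local

variable {F E : Type} [Field F] [NumberField F] [Field E] [NumberField E] [Algebra F E] {c : E ≃ₐ[F] E} {N : ℕ}
  {J : Matrix (Fin N) (Fin N) E}
  {μ : Measure (adelicGroupData F E c N J).automorphicQuotient}
  [SMulInvariantMeasure (adelicGroupData F E c N J).Adelic (adelicGroupData F E c N J).automorphicQuotient μ]

/-- **Every constituent class of `σ|_{U(J)(F_v)}`, `σ` irreducible admissible UNITARIZABLE, has a unitarizable representative**:
★ P2-CL gives an irreducible local type `τ_v` with `isotypicComponent (σ ∘ ι_v) τ_v = ⊤`; a constituent of `σ ∘ ι_v` is then a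
constituent of `τ_v` (★ Σ♭), i.e. `≅ τ_v` (★ `nonempty_equiv_of_isIrreducible`), and `τ_v` is unitarizable by §1.
[cite: FlathCorvallis1979, Thm. 3] [cite: BushnellHenniart2006, §1.1 and §2.6] -/
theorem exists_unitarizable_rep_of_isConstituentOf_comp_inclPlace {W : Type} [AddCommGroup W] [Module ℂ W]
    (σ : Representation ℂ (finAdelic F E c N J) W) (hirr : σ.IsIrreducible) (hadm : σ.IsAdmissible) (hu : σ.IsUnitarizable)
    (v : HeightOneSpectrum (𝓞 F)) (c₀ : IrrClass (localPi E c N J v))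
    (h : c₀.IsConstituentOf (σ.comp (inclPlace F E c N J v))) :
    ∃ r : SmoothIrrep (localPi E c N J v), IrrClass.mk r = c₀ ∧ r.ρ.IsUnitarizable := by
  obtain ⟨T, _, _, τ, hτirr, htop⟩ :=
    Summit.HodgeConjecture.HodgeConjecture.Cruxes.H413.F0P2cStubCLLocalTypeExists.stubCL_holds F E c N J W σ hirr hadm v
  haveI := hτirr
  haveI : IsSimpleModule ℂ[localPi E c N J v] τ.asModule := (Representation.irreducible_iff_isSimpleModule_asModule τ).mp hτirr
  haveI : Nontrivial W := IrrClass.nontrivial_of_isIrreducible σ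
  -- `τ_v` is unitarizable (§1 at `ρ = σ ∘ ι_v`)
  have hτu : τ.IsUnitarizable :=
    isUnitarizable_of_isotypicComponent_eq_top (ρ := σ.comp (inclPlace F E c N J v)) htop (isUnitarizable_comp hu (inclPlace F E c N J v))
  -- `c₀` is a constituent of `τ_v`, hence `≅ τ_v`
  have hc : c₀.IsConstituentOf (τ.comp (MonoidHom.id (localPi E c N J v))) := by
    refine IrrClass.IsConstituentOf.of_isotypicComponent_eq_top_comp htop (MonoidHom.id _) ?_
    rwa [MonoidHom.comp_id]
  rw [MonoidHom.comp_id] at hc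
  obtain ⟨r, rfl⟩ := IrrClass.mk_surjective c₀
  obtain ⟨e⟩ := hc.nonempty_equiv_of_isIrreducible
  exact ⟨r, rfl, isUnitarizable_of_injective e.toLinearMap
    (fun g x => Representation.IntertwiningMap.isIntertwining r.ρ τ e.toIntertwiningMap g x) e.toLinearEquiv.injective hτu⟩

/-- **THE PIN — the local constituents of a discrete automorphic `P` at a finite place are unitarizable.**  For a discrete automorphic
`P` of `U(J)` with an irreducible ADMISSIBLE finite component `σ` (★ `HasFinComponent`), a finite place `v` and a class
`c₀ ∈ Irr(U(J)(F_v))` that is a constituent of `P.finRep^∞ ∘ inclPlace v` (D6's (b2′) smooth-part currency), some representative of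
`c₀` carries a `U(J)(F_v)`-invariant positive-definite Hermitian form.  (★ T♭-core `smoothConstituents_iff_of_hasFinComponent` moves
the constituent to `σ ∘ inclPlace v`; then §2 + `exists_unitarizable_rep_of_isConstituentOf_comp_inclPlace`.)
[cite: BorelJacquet1979, §4.6] [cite: FlathCorvallis1979, Thm. 3] [cite: Rogawski1990, Prop. 13.8.1 p. 206] -/
theorem exists_unitarizable_rep_of_isConstituentOf_finRepSmooth_comp (P : DiscreteAutomorphicRep (adelicGroupData F E c N J) μ)
    {W : Type} [AddCommGroup W] [Module ℂ W] (σ : Representation ℂ (finAdelic F E c N J) W)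
    (hirr : σ.IsIrreducible) (hadm : σ.IsAdmissible) (hP : P.HasFinComponent σ)
    (v : HeightOneSpectrum (𝓞 F)) (c₀ : IrrClass (localPi E c N J v))
    (h : c₀.IsConstituentOf (P.finRep.smoothPart.toRepresentation.comp (inclPlace F E c N J v))) :
    ∃ r : SmoothIrrep (localPi E c N J v), IrrClass.mk r = c₀ ∧ r.ρ.IsUnitarizable :=
  exists_unitarizable_rep_of_isConstituentOf_comp_inclPlace σ hirr hadm (isUnitarizable_of_hasFinComponent P σ hirr hP) v c₀
    ((smoothConstituents_iff_of_hasFinComponent P hirr hadm hP v c₀).mp h)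

end Local

/-! ## §4 The CM frame, in D6 (b2′)'s binder types -/

section CM

variable {L : Type} [Field L] [NumberField L] [IsCMField L] {H : Matrix (Fin 3) (Fin 3) L}
  {μ : Measure (adelicGroupData (↥(maximalRealSubfield L)) L (IsCMField.complexConj L) 3 H).automorphicQuotient}
  [SMulInvariantMeasure (adelicGroupData (↥(maximalRealSubfield L)) L (IsCMField.complexConj L) 3 H).Adelic
    (adelicGroupData (↥(maximalRealSubfield L)) L (IsCMField.complexConj L) 3 H).automorphicQuotient μ]

/-- **The pin at the CM frame, D6 (b2′) currency VERBATIM**: for a discrete automorphic `P` of `U(H)`, `H ∈ M₃(L)`, with an irreducible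
admissible finite component `σ`, every finite place `v` of `L⁺` and class `c : IrrClass ((cmDatum L 3 H).Local v)` whose pull-back along
★ `localPiEquiv v` is a constituent of `P.finRep^∞ ∘ inclPlace v`, the pulled-back class has a UNITARIZABLE representative.
[cite: BorelJacquet1979, §4.6] [cite: Rogawski1990, Prop. 13.8.1 p. 206] -/
theorem exists_unitarizable_rep_of_comap_isConstituentOf_cm
    (P : DiscreteAutomorphicRep (adelicGroupData (↥(maximalRealSubfield L)) L (IsCMField.complexConj L) 3 H) μ)
    {W : Type} [AddCommGroup W] [Module ℂ W]
    (σ : Representation ℂ (finAdelic (↥(maximalRealSubfield L)) L (IsCMField.complexConj L) 3 H) W)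
    (hirr : σ.IsIrreducible) (hadm : σ.IsAdmissible) (hP : P.HasFinComponent σ)
    (v : HeightOneSpectrum (𝓞 ↥(maximalRealSubfield L))) (c : IrrClass ((cmDatum L 3 H).Local v))
    (h : (IrrClass.comap (localPiEquiv L (IsCMField.complexConj L) 3 H v) c).IsConstituentOf
      (P.finRep.smoothPart.toRepresentation.comp (inclPlace (↥(maximalRealSubfield L)) L (IsCMField.complexConj L) 3 H v))) :
    ∃ r : SmoothIrrep (localPi L (IsCMField.complexConj L) 3 H v),
      IrrClass.mk r = IrrClass.comap (localPiEquiv L (IsCMField.complexConj L) 3 H v) c ∧ r.ρ.IsUnitarizable :=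
  exists_unitarizable_rep_of_isConstituentOf_finRepSmooth_comp P σ hirr hadm hP v _ h

end CM

end Summit.HodgeConjecture.HodgeConjecture.Cruxes.H413.F0P3LocalConstituentsUnitary

end
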